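import Literature.NumberTheory.EllipticCurves.PadicPointsFiltration
import HarnessLib

/-!
# The canonical `p`-adic height: the admissible locus is a subgroup for every prime (`p = 2` included)

Trunk T-NT-EC (Literature/NumberTheory/EllipticCurves). This file DISCHARGES the named fact
`WeierstrassCurve.localConditionsLocus_isAddSubgroup` of `CanonicalPAdicHeightProofs.lean`: for `W/ℚ` globally
minimal (indeed for every `ℤ`-integral equation of an elliptic curve) and EVERY prime `p`, the set
`{O} ∪ {P = (x, y) ∈ E(ℚ) | ‖x‖_p > 1, z(P) = -x/y in the sigma disc ‖z‖_p < p^{-1/(p-1)}, P̃ non-singular mod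
every ℓ}` is (the underlying set of) a subgroup of `E(ℚ)`.

`CanonicalPAdicHeightParallelogramProofs.lean` proved this for `p ≠ 2`
(`WeierstrassCurve.exists_addSubgroup_coe_eq_localConditionsLocus`), where the sigma-disc clause is implied
by `P ∈ E₁(ℚ_p)` (`3v(x) = 2v(y) = -6r`, AEC VII.2.2). For `p = 2` the disc `‖z‖₂ < 1/2` cuts `E₁(ℚ₂)` down
to `E⁽²⁾(ℚ₂) = {P ∈ E₁(ℚ₂) : ‖z(P)‖ ≤ 1/4} ≅ Ê(4ℤ₂)`, which is a subgroup because "`𝓕(𝓜ⁿ)` is a subgroup of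
`𝓕(𝓜)`" (AEC IV.3, IV.3.2(a)) transported through `E₁(K) ≅ Ê(𝓜)`, `(x, y) ↦ -x/y` (AEC VII.2.2). In the tree
this subgroup is `WeierstrassCurve.formalFiltration (W ⊗ ℚ_p) n` of `PadicPointsFiltration.lean` (PROVED there
from the convergence of the chord–tangent formal group law on `E₁(ℚ_p)`, `formalGroupLaw_padicEval_holds`:
`‖z(P + Q)‖ ≤ max(‖z(P)‖, ‖z(Q)‖)`, `‖z(-P)‖ = ‖z(P)‖`). The present file pulls it back to `E(ℚ)` along the
base-change homomorphism `WeierstrassCurve.toPadicPoint : E(ℚ) →+ E(ℚ_p)` and intersects with the subgroups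
"`E₀(ℚ)` at `ℓ`" (`WeierstrassCurve.nonsingularReductionSubgroupAt`, AEC VII.2.1, parallelogram file),
uniformly in `p`:

  `H = toPadicPoint⁻¹(E⁽ⁿ⁰⁾(ℚ_p)) ⊓ ⨅_ℓ (E₀(ℚ) at ℓ)`,  `n₀ = 2` if `p = 2`, `n₀ = 1` otherwise.

## Contents (all proved; no definition, no new named fact)

* `Literature.NumberTheory.EllipticCurves.padicNorm_le_inv_pow_iff_inSigmaDisc` — for `z ∈ ℚ_p` with
  `‖z‖ < 1`: `‖z‖ ≤ p^{-n₀} ↔ ‖z‖ < p^{-1/(p-1)}` (discreteness of `‖·‖_p`: with `‖z‖ = p^{-v}`, `v ≥ 1`, both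
  sides say `v ≥ 2` when `p = 2`, and both hold when `p ≥ 3`);
* `WeierstrassCurve.some_mem_comap_toPadicPoint_formalFiltration_iff` — a rational affine point `(x, y)` lies
  in `toPadicPoint⁻¹(E⁽ⁿ⁾(ℚ_p))` iff `‖x‖_p > 1 ∧ ‖x/y‖_p ≤ p⁻ⁿ`;
* `WeierstrassCurve.some_mem_sigmaDiscSubgroup_iff` — for `n = n₀` this is `‖x‖_p > 1 ∧ InSigmaDisc p (-x/y)`,
  the first two local conditions of `SatisfiesLocalConditions`;
* `WeierstrassCurve.exists_addSubgroup_coe_eq_localConditionsLocus_of_isIntegral` — the locus theorem for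
  every `ℤ`-integral elliptic `W/ℚ` and every prime `p`;
* `WeierstrassCurve.localConditionsLocus_isAddSubgroup_holds` — the discharge (`IsGloballyMinimal ⇒ IsIntegral ℤ`
  is the instance `IsGloballyMinimal.isIntegral_int` of the parallelogram file).

## Sources (read)

* J. H. Silverman, *The Arithmetic of Elliptic Curves*, 2nd ed., GTM 106 (2009) [SilvermanAEC2009]: VII.2
  Prop. 2.1 (PDF pp. 167–169: "`E₀(K)` is a subgroup of `E(K)`", `0 → E₁(K) → E₀(K) → Ẽ_ns(k) → 0`),
  Prop. 2.2 (PDF p. 170: `Ê(𝓜) ⥲ E₁(K)`, inverse `(x, y) ↦ -x/y`, `3v(x) = 2v(y) = -6r`), IV.3 (PDF p. 115: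
  "`𝓕(𝓜ⁿ)` is a subgroup of `𝓕(𝓜)`"), IV.3.2(a) (PDF p. 116).
* W. Stein, C. Wuthrich, Math. Comp. 82 (2013), §4 (range of convergence `ord_p(t) > 1/(p-1)` of `σ`);
  B. Mazur, W. Stein, J. Tate, Doc. Math. Extra Vol. Coates (2006), §2.6 ("sufficiently small (finite index)
  subgroup").

## Design notes

* Pure proof file: no `def`. The subgroup is written out as `AddSubgroup.comap`/`⊓`/`⨅` of subgroups already
  in the tree, and `n₀` as the literal `if p = 2 then 2 else 1`.
* For odd `p`, `E⁽¹⁾ ∩ E(ℚ) = E₁ ∩ E(ℚ)` (`‖z‖ < 1 ⇒ ‖z‖ ≤ p⁻¹`), so the subgroup has the same underlying set as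
  the parallelogram file's `kernelOfReductionAt p ⊓ ⨅ nonsingularReductionSubgroupAt ℓ`; the proof here is
  uniform in `p` and does not use that theorem.
* Hypotheses are exactly those of the named fact (`IsElliptic` is needed by `formalFiltration`, whose closure
  under `+` rests on the formal group law of an ELLIPTIC curve; `IsIntegral ℤ` gives the `ℤ_p`-integrality of
  `W ⊗ ℚ_p`, instance `isIntegral_padicInt_baseChange`, and the local models at every `ℓ`).
-/

noncomputable section

open scoped Classical

namespace Literature.NumberTheory.EllipticCurves

variable (p : ℕ) [Fact p.Prime]

/-- **The sigma disc is a level of the `p`-adic filtration.** For `z ∈ ℚ_p` with `‖z‖ < 1`: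
`‖z‖ ≤ (p⁻¹)^{n₀}` with `n₀ = 2` for `p = 2` and `n₀ = 1` otherwise, iff `‖z‖ < p^{-1/(p-1)}`
(`WeierstrassCurve.InSigmaDisc`). Writing `‖z‖ = p^{-v}` with `v ≥ 1`: for `p = 2` both say `v ≥ 2`; for
`p ≥ 3` both hold. [Stein–Wuthrich 2013, §4 (`ord_p(t) > 1/(p-1)`); Silverman AEC IV.6.4(b)] [folklore] -/
theorem padicNorm_le_inv_pow_iff_inSigmaDisc {z : ℚ_[p]} (hz : ‖z‖ < 1) :
    ‖z‖ ≤ ((p : ℝ)⁻¹) ^ (if p = 2 then 2 else 1) ↔ WeierstrassCurve.InSigmaDisc p z := by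
  unfold WeierstrassCurve.InSigmaDisc
  have hp : p.Prime := Fact.out
  have hp1 : (1 : ℝ) < p := by exact_mod_cast hp.one_lt
  have hp0 : (0 : ℝ) < p := one_pos.trans hp1
  by_cases hz0 : z = 0
  · subst hz0
    rw [norm_zero]
    exact ⟨fun _ => Real.rpow_pos_of_pos hp0 _,
      fun _ => pow_nonneg (inv_nonneg.mpr (Nat.cast_nonneg p)) _⟩
  rw [Padic.norm_eq_zpow_neg_valuation hz0] at hz ⊢
  have hv1 : 1 ≤ z.valuation := by
    by_contra hle
    exact (one_le_zpow₀ hp1.le (by omega)).not_gt hz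
  rw [inv_pow, ← zpow_natCast, ← zpow_neg, zpow_le_zpow_iff_right₀ hp1, neg_le_neg_iff,
    ← Real.rpow_intCast, Real.rpow_lt_rpow_left_iff hp1, Int.cast_neg, neg_lt_neg_iff,
    div_lt_iff₀ (by linarith : (0 : ℝ) < p - 1)]
  split_ifs with h2
  · subst h2
    have e : ((z.valuation : ℝ)) * ((2 : ℕ) - 1 : ℝ) = ((z.valuation : ℤ) : ℝ) := by push_cast; ring
    rw [e, show (1 : ℝ) = ((1 : ℤ) : ℝ) by norm_num, Int.cast_lt]
    push_cast
    omega
  · have hp3 : (3 : ℝ) ≤ p := by exact_mod_cast lt_of_le_of_ne hp.two_le (Ne.symm h2)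
    have hv1' : (1 : ℝ) ≤ z.valuation := by exact_mod_cast hv1
    push_cast
    exact ⟨fun _ => by nlinarith, fun _ => hv1⟩

end Literature.NumberTheory.EllipticCurves

namespace WeierstrassCurve

open Literature.NumberTheory.EllipticCurves

section RationalPoints

variable (W : WeierstrassCurve ℚ) [W.IsElliptic] [W.IsIntegral ℤ] (p : ℕ) [Fact p.Prime]

variable {W p} in
/-- **`E(ℚ) ∩ E⁽ⁿ⁾(ℚ_p)` in coordinates.** A rational affine point `(x, y)` of a `ℤ`-integral elliptic `W/ℚ`
lies in the pull-back of the level-`n` subgroup `E⁽ⁿ⁾(ℚ_p) = {P ∈ E₁(ℚ_p) : ‖z(P)‖ ≤ p⁻ⁿ}`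
(`WeierstrassCurve.formalFiltration`) along `E(ℚ) → E(ℚ_p)` iff `‖x‖_p > 1` and `‖-x/y‖_p ≤ p⁻ⁿ`.
[Silverman AEC VII.2.2 (`E₁(K) ≅ Ê(𝓜)`, `(x, y) ↦ -x/y`), IV.3 (`Ê(𝓜ⁿ)`)] [folklore] -/
theorem some_mem_comap_toPadicPoint_formalFiltration_iff (n : ℕ) {x y : ℚ} (h : W.toAffine.Nonsingular x y) :
    (.some x y h : W.toAffine.Point) ∈
        ((W.baseChange ℚ_[p]).formalFiltration n).comap (W.toPadicPoint p) ↔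
      1 < ‖(x : ℚ_[p])‖ ∧ ‖-(x : ℚ_[p]) / y‖ ≤ ((p : ℝ)⁻¹) ^ n := by
  rw [AddSubgroup.mem_comap, mem_formalFiltration_iff, toPadicPoint_some, isInReductionKernel_some,
    formalParameter_some]

variable {W p} in
/-- **The first two local conditions cut out `E(ℚ) ∩ E⁽ⁿ⁰⁾(ℚ_p)`** (`n₀ = 2` for `p = 2`, `1` otherwise): for a
rational affine point `(x, y)`, `(x, y) ∈ toPadicPoint⁻¹(E⁽ⁿ⁰⁾(ℚ_p))` iff `‖x‖_p > 1` and `z = -x/y` lies in the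
sigma disc `‖z‖_p < p^{-1/(p-1)}` — since `P ∈ E₁(ℚ_p)` forces `‖z(P)‖ < 1` (AEC VII.2.2: `3v(x) = 2v(y) = -6r`,
`r ≥ 1`) and `‖·‖_p` is discrete (`padicNorm_le_inv_pow_iff_inSigmaDisc`). For `p = 2` this is the subgroup
`Ê(4ℤ₂)` of AEC IV.3.2(a); for odd `p` it is all of `E(ℚ) ∩ E₁(ℚ_p)`.
[Silverman AEC VII.2.2, IV.3.2(a); Stein–Wuthrich 2013, §4] [folklore] -/
theorem some_mem_sigmaDiscSubgroup_iff {x y : ℚ} (h : W.toAffine.Nonsingular x y) :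
    (.some x y h : W.toAffine.Point) ∈
        ((W.baseChange ℚ_[p]).formalFiltration (if p = 2 then 2 else 1)).comap (W.toPadicPoint p) ↔
      1 < ‖(x : ℚ_[p])‖ ∧ InSigmaDisc p (-(x : ℚ_[p]) / y) := by
  rw [some_mem_comap_toPadicPoint_formalFiltration_iff]
  refine and_congr_right fun hx => padicNorm_le_inv_pow_iff_inSigmaDisc p ?_
  have hk : (W.baseChange ℚ_[p]).IsInReductionKernel (.some _ _ (nonsingular_ratCast (p := p) h)) := hx
  have hlt := (W.baseChange ℚ_[p]).norm_formalParameter_lt_one hk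
  rwa [formalParameter_some] at hlt

/-- **The admissible locus with `O` is a subgroup of `E(ℚ)`, for every prime `p`.** For a `ℤ`-integral
equation `W/ℚ` of an elliptic curve and any prime `p`, `{O} ∪ {P | SatisfiesLocalConditions p P}` is the
underlying set of the subgroup `toPadicPoint⁻¹(E⁽ⁿ⁰⁾(ℚ_p)) ⊓ ⨅_ℓ (E₀(ℚ) at ℓ)` (`n₀ = 2` if `p = 2`, else `1`):
`E₀` at `ℓ` is a subgroup by AEC VII.2.1 (`nonsingularReductionSubgroupAt`, through the local model over
`ℤ_(ℓ)`), `E⁽ⁿ⁾(ℚ_p) ≅ Ê(𝓜ⁿ)` is a subgroup by AEC IV.3 / IV.3.2(a) and VII.2.2 (`formalFiltration`), and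
`E(ℚ) → E(ℚ_p)` is a homomorphism. Extends `exists_addSubgroup_coe_eq_localConditionsLocus` (`p ≠ 2`) of the
parallelogram file to `p = 2`. [Silverman AEC VII.2.1, VII.2.2, IV.3.2(a); Mazur–Stein–Tate 2006, §2.6]
[cite: SilvermanAEC2009, VII.2.1] -/
theorem exists_addSubgroup_coe_eq_localConditionsLocus_of_isIntegral :
    ∃ H : AddSubgroup W.toAffine.Point, (H : Set W.toAffine.Point) = W.localConditionsLocus p := by
  refine ⟨((W.baseChange ℚ_[p]).formalFiltration (if p = 2 then 2 else 1)).comap (W.toPadicPoint p) ⊓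
    ⨅ ℓ : Nat.Primes, (haveI : Fact ℓ.1.Prime := ⟨ℓ.2⟩; W.nonsingularReductionSubgroupAt ℓ.1), ?_⟩
  ext P
  rw [SetLike.mem_coe, AddSubgroup.mem_inf, AddSubgroup.mem_iInf, mem_localConditionsLocus_iff]
  rcases P with _ | ⟨x, y, h⟩
  · simp only [WeierstrassCurve.Affine.Point.zero_def, true_or, iff_true]
    exact ⟨AddSubgroup.zero_mem _, fun ℓ => AddSubgroup.zero_mem _⟩
  · rw [some_mem_sigmaDiscSubgroup_iff]
    constructor
    · rintro ⟨⟨hx, hdisc⟩, hns⟩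
      refine Or.inr ⟨hx, hdisc, fun ℓ hℓ => ?_⟩
      haveI : Fact ℓ.Prime := ⟨hℓ⟩
      exact (mem_nonsingularReductionSubgroupAt_iff _).mp (hns ⟨ℓ, hℓ⟩)
    · rintro (h0 | ⟨hx, hdisc, hns⟩)
      · exact (WeierstrassCurve.Affine.Point.some_ne_zero h h0).elim
      · exact ⟨⟨hx, hdisc⟩, fun ℓ => by
          haveI : Fact ℓ.1.Prime := ⟨ℓ.2⟩
          exact (mem_nonsingularReductionSubgroupAt_iff _).mpr (hns ℓ.1 ℓ.2)⟩

end RationalPoints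

/-- **Discharge of the named fact `localConditionsLocus_isAddSubgroup`** (`CanonicalPAdicHeightProofs.lean`):
for `W/ℚ` globally minimal — hence `ℤ`-integral, instance `IsGloballyMinimal.isIntegral_int` — elliptic, and
every prime `p`, `{O} ∪ {admissible locus}` is the underlying set of a subgroup of `E(ℚ)`
(`exists_addSubgroup_coe_eq_localConditionsLocus_of_isIntegral`: `E(ℚ) ∩ E⁽ⁿ⁰⁾(ℚ_p) ∩ ⋂_ℓ E₀(ℚ_ℓ)`, AEC VII.2.1,
VII.2.2, IV.3.2(a)). [Silverman AEC VII.2 Prop. 2.1 (PDF pp. 167–169), Prop. 2.2 (PDF p. 170), IV.3.2(a)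
(PDF p. 116)] [cite: SilvermanAEC2009, VII.2.1] -/
theorem localConditionsLocus_isAddSubgroup_holds : localConditionsLocus_isAddSubgroup :=
  fun W _ _ p _ => W.exists_addSubgroup_coe_eq_localConditionsLocus_of_isIntegral p

end WeierstrassCurve
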